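import Summits.Ventures.HodgeRepro2.T5SU11JacobiPhaseLipschitz
import Summits.Ventures.HodgeRepro2.T5SU11JacobiPhaseTailXi

/-!
# The tail of the phase at a general threshold, uniformly in `0 ≤ λ ≤ 2`: `|P_{k,λ}(log|a| > τ) − e^{−(k−2)τ}| ≤ c(τ + 2/(k − 2)) e^{−(k−2)τ}`

With the Lipschitz bound `1 − c s ≤ Φ_λ(s) ≤ 1`, `c = λ(2 − λ)/2 ≤ 1/2`, of `T5SU11JacobiPhaseLipschitz`
(`0 ≤ λ ≤ 2`), the Laplace tails `N(a) = ∫_a^∞ e^{−(k−2)s} Φ_λ(s) ds` of the phase are pinned: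

  **`e^{−(k−2)a} (1 − c(a + 1/(k − 2)))/(k − 2) ≤ N(a) ≤ e^{−(k−2)a}/(k − 2)`**   (`le_tail`, `tail_le`),

so the tail probability `N(a)/N(0) = P_{k,λ}(log|a| > a)` (`T5SU11JacobiPhaseTailGroup`, `T5SU11JacobiLaplacePhase`)
satisfies, for `k ≥ 3` and `a ≥ 0`,

  **`e^{−(k−2)a} (1 − c(a + 1/(k − 2))) ≤ N(a)/N(0) ≤ e^{−(k−2)a}/(1 − c/(k − 2))`**   (`tail_prob_ge'`, `tail_prob_le'`),

hence the **general-threshold rate**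

  **`|P_{k,λ}(log|a| > τ) − e^{−(k−2)τ}| ≤ c (τ + 2/(k − 2)) e^{−(k−2)τ}`**
  (`abs_tail_prob_sub_exp_le'`, on the group `abs_phase_tail_prob_sub_exp_le'`):

for every `λ ∈ [0, 2]` the tail of the phase under `m_k φ_λ dν/m̂_k(λ)` is the exponential tail `e^{−(k−2)τ}`
of the `λ = 0` law (`T5SU11PhaseTail`) up to the relative error `c(τ + 2/(k − 2))`. The rescaled form
(`τ = x/k`, the rate `O(1/k)` of the limit law) is `T5SU11JacobiPhaseLawRateScaled`. Nothing is claimed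
about (N).

Blind lane: Mathlib + the HodgeRepro2 prefix only; no sorry; axioms ⊆ {propext, Classical.choice,
Quot.sound}.
-/

namespace Summit.Ventures.HodgeRepro2.T5SU11JacobiPhaseLawRate

open MeasureTheory MeasureTheory.Measure Metric Set Filter Topology
open T5SU11Unimodular T5SU11Fibration T5SU11Cartan T5SU11OneParameter T5SU11CartanProjection T5HaarCircle
  T5BergmanCoefficient T5SU11FibrationHaar T5SU11SphericalFunction T5SU11SphericalSymmetry
  T5SU11SphericalBounds T5SU11SphericalContinuous T5SU11JacobiIwasawa T5SU11JacobiTransform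
  T5SU11JacobiWeight T5SU11KFiniteMajorantPow T5SU11JacobiLaplacePhase T5SU11JacobiPhaseTailGroup
  T5SU11JacobiPhaseTailRate T5SU11JacobiPhaseTailXi T5SU11JacobiPhaseLipschitz
open scoped Real


/-! ### Elementary inequalities -/

/-- `e^y − 1 ≤ y e^y` (from `1 − y ≤ e^{−y}`). -/
theorem exp_sub_one_le_mul_exp (y : ℝ) : Real.exp y - 1 ≤ y * Real.exp y := by
  have h := Real.add_one_le_exp (-y)
  have hpos := Real.exp_pos y
  have : Real.exp (-y) * Real.exp y = 1 := by rw [← Real.exp_add, neg_add_cancel, Real.exp_zero]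
  nlinarith

/-- `1/(1 − η) ≤ 1 + 2η` for `0 ≤ η ≤ 1/2`. -/
theorem inv_one_sub_le {η : ℝ} (h0 : 0 ≤ η) (h1 : η ≤ 1 / 2) : 1 / (1 - η) ≤ 1 + 2 * η := by
  rw [div_le_iff₀ (by linarith)]
  nlinarith

/-- `∫_a^∞ e^{−rs} ds = e^{−ra}/r` for `r > 0`. -/
theorem integral_exp_neg_mul_Ioi_eq {r : ℝ} (hr : 0 < r) (a : ℝ) :
    ∫ s in Ioi a, Real.exp (-(r * s)) = Real.exp (-(r * a)) / r := by
  have e : ∀ s : ℝ, Real.exp (-(r * s)) = Real.exp (-r * s) := fun s => by ring_nf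
  simp_rw [e]
  rw [integral_exp_mul_Ioi (by linarith) a]
  ring_nf

/-- `∫_a^∞ s e^{−rs} ds = e^{−ra}(a/r + 1/r²)` for `r > 0`. -/
theorem integral_mul_exp_neg_mul_Ioi_eq {r : ℝ} (hr : 0 < r) (a : ℝ) :
    ∫ s in Ioi a, s * Real.exp (-(r * s)) = Real.exp (-(r * a)) * (a / r + 1 / r ^ 2) := by
  have h := integral_affine_mul_exp_Ioi hr 0 a
  simp only [zero_add] at h
  exact h

/-- `(1 − c s) e^{−rs}` is integrable on `(a, ∞)` for `r > 0`. -/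
theorem integrableOn_one_sub_mul_exp_Ioi {r : ℝ} (hr : 0 < r) (c a : ℝ) :
    IntegrableOn (fun s : ℝ => (1 - c * s) * Real.exp (-(r * s))) (Ioi a) := by
  have h1 : IntegrableOn (fun s : ℝ => Real.exp (-(r * s))) (Ioi a) := by
    refine (integrableOn_exp_mul_Ioi (by linarith : -r < 0) a).congr_fun (fun s _ => ?_) measurableSet_Ioi
    simp only
    ring_nf
  have h2 : IntegrableOn (fun s : ℝ => (0 + s) * Real.exp (-(r * s))) (Ioi a) :=
    integrableOn_affine_mul_exp_Ioi hr 0 a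
  refine (h1.sub (h2.const_mul c)).congr_fun (fun s _ => ?_) measurableSet_Ioi
  simp only [Pi.sub_apply, zero_add]
  ring

section measure

variable [MeasurableSpace Circle] [BorelSpace Circle]

/-! ### The Laplace tails pinned by the Lipschitz bound -/

/-- **The upper bound on the tail**: for `k > 2`, `0 ≤ λ ≤ 2`, `a ≥ 0`,
`∫_a^∞ e^{−(k−2)s} Φ_λ(s) ds ≤ e^{−(k−2)a}/(k − 2)`. -/
theorem tail_le {k lam a : ℝ} (hk : 2 < k) (h0 : 0 ≤ lam) (h2 : lam ≤ 2) (ha : 0 ≤ a) :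
    ∫ s in Ioi a, Real.exp (-((k - 2) * s)) * sphPhase lam s
      ≤ Real.exp (-((k - 2) * a)) / (k - 2) := by
  have hr : 0 < k - 2 := by linarith
  have hint1 : IntegrableOn (fun s : ℝ => Real.exp (-((k - 2) * s))) (Ioi a) := by
    refine (integrableOn_exp_mul_Ioi (by linarith : -(k - 2) < 0) a).congr_fun (fun s _ => ?_)
      measurableSet_Ioi
    simp only
    ring_nf
  rw [← integral_exp_neg_mul_Ioi_eq hr a]
  refine setIntegral_mono_on
    ((integrableOn_exp_mul_sphPhase (by linarith) (by linarith) (by linarith)).mono_set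
      (Ioi_subset_Ioi ha)) hint1 measurableSet_Ioi fun s _ => ?_
  exact mul_le_of_le_one_right (Real.exp_pos _).le (sphPhase_le_one h0 h2 s)

/-- **The lower bound on the tail**: for `k > 2`, `0 ≤ λ ≤ 2`, `a ≥ 0`, with `c = λ(2 − λ)/2`,
`e^{−(k−2)a} (1 − c(a + 1/(k − 2)))/(k − 2) ≤ ∫_a^∞ e^{−(k−2)s} Φ_λ(s) ds`. -/
theorem le_tail {k lam a : ℝ} (hk : 2 < k) (h0 : 0 ≤ lam) (h2 : lam ≤ 2) (ha : 0 ≤ a) :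
    Real.exp (-((k - 2) * a)) * (1 - lam * (2 - lam) / 2 * (a + 1 / (k - 2))) / (k - 2)
      ≤ ∫ s in Ioi a, Real.exp (-((k - 2) * s)) * sphPhase lam s := by
  have hr : 0 < k - 2 := by linarith
  set c : ℝ := lam * (2 - lam) / 2 with hc
  have hint1 : IntegrableOn (fun s : ℝ => Real.exp (-((k - 2) * s))) (Ioi a) := by
    refine (integrableOn_exp_mul_Ioi (by linarith : -(k - 2) < 0) a).congr_fun (fun s _ => ?_)
      measurableSet_Ioi
    simp only
    ring_nf
  have hint2 : IntegrableOn (fun s : ℝ => s * Real.exp (-((k - 2) * s))) (Ioi a) := by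
    refine (integrableOn_affine_mul_exp_Ioi hr 0 a).congr_fun (fun s _ => ?_) measurableSet_Ioi
    simp only [zero_add]
  have hval : ∫ s in Ioi a, (1 - c * s) * Real.exp (-((k - 2) * s))
      = Real.exp (-((k - 2) * a)) * (1 - c * (a + 1 / (k - 2))) / (k - 2) := by
    have e : ∀ s : ℝ, (1 - c * s) * Real.exp (-((k - 2) * s))
        = Real.exp (-((k - 2) * s)) - c * (s * Real.exp (-((k - 2) * s))) := fun s => by ring
    simp_rw [e]
    rw [integral_sub hint1 (hint2.const_mul c), integral_const_mul, integral_exp_neg_mul_Ioi_eq hr a,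
      integral_mul_exp_neg_mul_Ioi_eq hr a]
    field_simp
  rw [← hval]
  refine setIntegral_mono_on (integrableOn_one_sub_mul_exp_Ioi hr c a)
    ((integrableOn_exp_mul_sphPhase (by linarith) (by linarith) (by linarith)).mono_set
      (Ioi_subset_Ioi ha)) measurableSet_Ioi fun s hs => ?_
  have hs0 : 0 ≤ s := by linarith [mem_Ioi.mp hs]
  rw [mul_comm]
  exact mul_le_mul_of_nonneg_left (one_sub_mul_le_sphPhase h0 h2 hs0) (Real.exp_pos _).le

/-- The mass `N(0)` is positive. -/
theorem tail_zero_pos {k lam : ℝ} (hk : 2 < k) (h0 : 0 ≤ lam) (h2 : lam ≤ 2) :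
    0 < ∫ s in Ioi (0 : ℝ), Real.exp (-((k - 2) * s)) * sphPhase lam s := by
  have hpos : 0 < ∫ g, (1 - ‖orbit g‖ ^ 2) ^ (k / 2) * sph lam g ∂(nu haarCircle) :=
    jacobi_pos (by linarith) (by linarith) (by linarith)
  rw [jacobi_eq_laplace_phase (by linarith) (by linarith) (by linarith)] at hpos
  exact pos_of_mul_pos_right hpos (by positivity)

/-! ### The two-sided bound on the tail probability, general threshold -/

/-- **THE TAIL PROBABILITY FROM ABOVE, general threshold**: for `k ≥ 3`, `0 ≤ λ ≤ 2`, `a ≥ 0`,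
`N(a)/N(0) ≤ e^{−(k−2)a}/(1 − c/(k − 2))`, `c = λ(2 − λ)/2`. -/
theorem tail_prob_le' {k lam a : ℝ} (hk : 3 ≤ k) (h0 : 0 ≤ lam) (h2 : lam ≤ 2) (ha : 0 ≤ a) :
    (∫ s in Ioi a, Real.exp (-((k - 2) * s)) * sphPhase lam s)
        / ∫ s in Ioi (0 : ℝ), Real.exp (-((k - 2) * s)) * sphPhase lam s
      ≤ Real.exp (-((k - 2) * a)) / (1 - lam * (2 - lam) / 2 / (k - 2)) := by
  have hk2 : 2 < k := by linarith
  have hr : 0 < k - 2 := by linarith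
  set c : ℝ := lam * (2 - lam) / 2 with hc
  have hc0 : 0 ≤ c := by rw [hc]; nlinarith
  have hc1 : c ≤ 1 / 2 := by rw [hc]; nlinarith [sq_nonneg (lam - 1)]
  have hη : c / (k - 2) ≤ 1 / 2 := by
    rw [div_le_iff₀ hr]
    linarith
  have hden : 0 < 1 - c / (k - 2) := by linarith
  have hN0 : Real.exp (-((k - 2) * 0)) * (1 - c * (0 + 1 / (k - 2))) / (k - 2)
      ≤ ∫ s in Ioi (0 : ℝ), Real.exp (-((k - 2) * s)) * sphPhase lam s := le_tail hk2 h0 h2 le_rfl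
  simp only [mul_zero, neg_zero, Real.exp_zero, one_mul, zero_add, mul_one_div] at hN0
  have hNx := tail_le hk2 h0 h2 ha
  have hN0pos := tail_zero_pos hk2 h0 h2
  rw [div_le_div_iff₀ hN0pos hden]
  calc (∫ s in Ioi a, Real.exp (-((k - 2) * s)) * sphPhase lam s) * (1 - c / (k - 2))
      ≤ Real.exp (-((k - 2) * a)) / (k - 2) * (1 - c / (k - 2)) :=
        mul_le_mul_of_nonneg_right hNx hden.le
    _ = Real.exp (-((k - 2) * a)) * ((1 - c / (k - 2)) / (k - 2)) := by ring
    _ ≤ Real.exp (-((k - 2) * a))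
          * ∫ s in Ioi (0 : ℝ), Real.exp (-((k - 2) * s)) * sphPhase lam s :=
        mul_le_mul_of_nonneg_left hN0 (Real.exp_pos _).le

/-- **THE TAIL PROBABILITY FROM BELOW, general threshold**: for `k ≥ 3`, `0 ≤ λ ≤ 2`, `a ≥ 0`,
`e^{−(k−2)a} (1 − c(a + 1/(k − 2))) ≤ N(a)/N(0)`, `c = λ(2 − λ)/2`. -/
theorem tail_prob_ge' {k lam a : ℝ} (hk : 3 ≤ k) (h0 : 0 ≤ lam) (h2 : lam ≤ 2) (ha : 0 ≤ a) :
    Real.exp (-((k - 2) * a)) * (1 - lam * (2 - lam) / 2 * (a + 1 / (k - 2)))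
      ≤ (∫ s in Ioi a, Real.exp (-((k - 2) * s)) * sphPhase lam s)
        / ∫ s in Ioi (0 : ℝ), Real.exp (-((k - 2) * s)) * sphPhase lam s := by
  have hk2 : 2 < k := by linarith
  have hr : 0 < k - 2 := by linarith
  set c : ℝ := lam * (2 - lam) / 2 with hc
  have hN0 := tail_le hk2 h0 h2 (le_refl (0 : ℝ))
  simp only [mul_zero, neg_zero, Real.exp_zero] at hN0
  have hNx := le_tail hk2 h0 h2 ha
  have hN0pos := tail_zero_pos hk2 h0 h2
  set L : ℝ := Real.exp (-((k - 2) * a)) * (1 - c * (a + 1 / (k - 2))) with hL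
  rw [le_div_iff₀ hN0pos]
  rcases le_or_gt 0 L with hL0 | hL0
  · calc L * ∫ s in Ioi (0 : ℝ), Real.exp (-((k - 2) * s)) * sphPhase lam s
        ≤ L * (1 / (k - 2)) := mul_le_mul_of_nonneg_left hN0 hL0
      _ = Real.exp (-((k - 2) * a)) * (1 - c * (a + 1 / (k - 2))) / (k - 2) := by
          rw [hL]; ring
      _ ≤ _ := hNx
  · calc L * ∫ s in Ioi (0 : ℝ), Real.exp (-((k - 2) * s)) * sphPhase lam s ≤ 0 :=
          mul_nonpos_of_nonpos_of_nonneg hL0.le hN0pos.le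
      _ ≤ _ := integral_nonneg fun s => mul_nonneg (Real.exp_pos _).le (sphPhase_pos lam s).le

/-- **THE RATE AT A GENERAL THRESHOLD**: for `k ≥ 3`, `0 ≤ λ ≤ 2`, `a ≥ 0`,
`|N(a)/N(0) − e^{−(k−2)a}| ≤ c (a + 2/(k − 2)) e^{−(k−2)a}`, `c = λ(2 − λ)/2` — the tail of the phase is
the exponential tail `e^{−(k−2)a}` of the `λ = 0` law up to a relative error `c(a + 2/(k − 2))`. -/
theorem abs_tail_prob_sub_exp_le' {k lam a : ℝ} (hk : 3 ≤ k) (h0 : 0 ≤ lam) (h2 : lam ≤ 2)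
    (ha : 0 ≤ a) :
    |(∫ s in Ioi a, Real.exp (-((k - 2) * s)) * sphPhase lam s)
        / (∫ s in Ioi (0 : ℝ), Real.exp (-((k - 2) * s)) * sphPhase lam s) - Real.exp (-((k - 2) * a))|
      ≤ lam * (2 - lam) / 2 * (a + 2 / (k - 2)) * Real.exp (-((k - 2) * a)) := by
  have hr : 0 < k - 2 := by linarith
  have hup := tail_prob_le' hk h0 h2 ha
  have hlo := tail_prob_ge' hk h0 h2 ha
  set c : ℝ := lam * (2 - lam) / 2 with hc
  have hc0 : 0 ≤ c := by rw [hc]; nlinarith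
  have hc1 : c ≤ 1 / 2 := by rw [hc]; nlinarith [sq_nonneg (lam - 1)]
  set η : ℝ := c / (k - 2) with hη
  have hη0 : 0 ≤ η := div_nonneg hc0 hr.le
  have hηhalf : η ≤ 1 / 2 := by
    rw [hη, div_le_iff₀ hr]
    linarith
  set A : ℝ := Real.exp (-((k - 2) * a)) with hA
  have hApos : 0 < A := Real.exp_pos _
  have hainv : 0 ≤ a + 1 / (k - 2) := by positivity
  have h2η : 2 * η ≤ c * (a + 2 / (k - 2)) := by
    rw [hη]
    have : 2 * (c / (k - 2)) = c * (2 / (k - 2)) := by ring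
    rw [this]
    apply mul_le_mul_of_nonneg_left _ hc0
    linarith [div_nonneg (le_refl (0 : ℝ)) hr.le, ha]
  have hδ : c * (a + 1 / (k - 2)) ≤ c * (a + 2 / (k - 2)) := by
    apply mul_le_mul_of_nonneg_left _ hc0
    have : 1 / (k - 2) ≤ 2 / (k - 2) := by
      apply div_le_div_of_nonneg_right _ hr.le
      norm_num
    linarith
  rw [abs_le]
  constructor
  · -- lower: `A − T ≤ A c (a + 1/(k−2))`
    have : A * (1 - c * (a + 1 / (k - 2))) = A - A * (c * (a + 1 / (k - 2))) := by ring
    nlinarith [mul_le_mul_of_nonneg_left hδ hApos.le]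
  · -- upper: `T − A ≤ A (1/(1−η) − 1) ≤ A · 2η`
    have h1 : A / (1 - η) ≤ A * (1 + 2 * η) := by
      rw [div_eq_mul_one_div]
      exact mul_le_mul_of_nonneg_left (inv_one_sub_le hη0 hηhalf) hApos.le
    nlinarith [mul_le_mul_of_nonneg_left h2η hApos.le]

/-- **ON THE GROUP, general threshold**: for `k ≥ 3`, `0 ≤ λ ≤ 2`, `t ≥ 0`,
`|P_{k,λ}(log|a| > t) − e^{−(k−2)t}| ≤ c (t + 2/(k − 2)) e^{−(k−2)t}`, `c = λ(2 − λ)/2`, for the probability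
measure `m_k φ_λ dν/m̂_k(λ)`. -/
theorem abs_phase_tail_prob_sub_exp_le' {k lam t : ℝ} (hk : 3 ≤ k) (h0 : 0 ≤ lam) (h2 : lam ≤ 2)
    (ht : 0 ≤ t) :
    |(∫ g in {g : SU11 | t < Real.log ‖mat g 0 0‖},
          (1 - ‖orbit g‖ ^ 2) ^ (k / 2) * sph lam g ∂(nu haarCircle))
        / (∫ g, (1 - ‖orbit g‖ ^ 2) ^ (k / 2) * sph lam g ∂(nu haarCircle)) - Real.exp (-((k - 2) * t))|
      ≤ lam * (2 - lam) / 2 * (t + 2 / (k - 2)) * Real.exp (-((k - 2) * t)) := by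
  rw [integral_phase_tail_eq (by linarith) (by linarith) (by linarith) ht,
    jacobi_eq_laplace_phase (by linarith) (by linarith) (by linarith),
    mul_div_mul_left _ _ (by positivity : (2 * π : ℝ) ≠ 0)]
  exact abs_tail_prob_sub_exp_le' hk h0 h2 ht

end measure

end Summit.Ventures.HodgeRepro2.T5SU11JacobiPhaseLawRate
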